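import Summits.SmoothPoincare4.SmoothPoincare4.Theorems.SblfDescentRungOneHelperDxCircle
import Summits.SmoothPoincare4.SmoothPoincare4.Theorems.SblfDescentRungOneHelperDxAngle
import Summits.SmoothPoincare4.SmoothPoincare4.Theorems.SblfDescentRungOneHelperDxStep
import Mathlib.Analysis.SpecialFunctions.SmoothTransition
import HarnessLib

/-!
# Disc extension, layer 5: the zone formulas on the torus disc

Auxiliary file of helper `helper_sliceGluing_discExtension` (apex leaf DX: extension of the
torus angular coordinate over the torus disc), line `Sketch`, crux `SblfDescent.RungOne`.

(Crux item stmt-SmoothPoincare4-18531; skeleton `Cruxes/RungOne/Lines/Sketch.lean`.)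

Abstract setting: a trivialisation `Ψ₀ : Fb → T` of the reference fibre (`T = Circle × Circle`),
the comparison family `Θ w ∈ Diff(T)` over the band annulus (so that the angular coordinate on
the band is `(θ, w) ↦ (Θ w (Ψ₀ θ)).1`), a straightened loop family `P σ t` of the base circle
of radius `a - 2d` (layer 4: `P 1 t = Θ ((a - 2d) • circlePt (stepQ t))`, `P σ t = id` for
`t ∉ (0, 1)`, `(P 0 (stepQ (fract t)) x).1 = e^{2πi g t} x.1`) and its smooth periodic phase
`g`, flat near `ℤ`.  With the cutoffs `cup`, `cdown` and seven equally spaced radii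
`a - 7d < ⋯ < a - d < a` we write the **zone formulas** in polar form `(θ, ‖w‖, angW w)`:

* `G2 θ r t = (Θ (Rf r • circlePt (Tf r t)) (Ψ₀ θ)).1` — freeze the radius to `a - 2d`
  (`Rf`) and flatten the angle to `perStep` (`Tf`) as `r` decreases from `a - d` to `a - 3d`;
* `G3 θ r t = e^{2πi (κ(r) - 1) g(t)} · (P (λ r) (stepQ (fract t)) (Ψ₀ θ)).1` — run the
  Earle–Eells deformation `λ : 1 → 0` on `[a - 5d, a - 4d]`, then unwind the translation loop
  `κ : 1 → 0` on `[a - 7d, a - 6d]`;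

and prove the identities gluing consecutive zones (`G2_eq_outer`, `G2_eq_G3`, `G3_eq_inner`),
their `1`-periodicity in `t`, and their joint smoothness in `(θ, r, t)` (`contMDiffAt_G2`,
`contMDiff_G3`).  Everything is folklore calculus.
-/

set_option linter.dupNamespace false

noncomputable section

open scoped Manifold ContDiff Topology Real
open Set Function Metric Literature.Topology.FourManifolds

namespace Summit.SmoothPoincare4.SmoothPoincare4.Cruxes.RungOne.Sketch

namespace DiscExt

/-- Local notation: `𝔼 n` is the model Euclidean space `EuclideanSpace ℝ (Fin n)`. -/
local notation "𝔼 " n:arg => EuclideanSpace ℝ (Fin n)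

/-- Local notation: `𝕊¹`, the unit circle of `ℝ²`. -/
local notation "𝕊¹" => (Metric.sphere (0 : EuclideanSpace ℝ (Fin 2)) (1 : ℝ))

/-- Local notation: the model with corners of the torus `Circle × Circle`. -/
local notation "𝓣" => (ModelWithCorners.prod (𝓡 1) (𝓡 1))

attribute [local instance] Literature.Topology.FourManifolds.fact_finrank_euclideanSpace_succ

/-! ### Cutoffs -/

/-- **Rising cutoff** `cup lo hi r`: `0` for `r ≤ lo`, `1` for `r ≥ hi`, smooth. [folklore] -/
def cup (lo hi r : ℝ) : ℝ := Real.smoothTransition ((r - lo) / (hi - lo))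

/-- **Falling cutoff** `cdown lo hi r = 1 - cup lo hi r`: `1` for `r ≤ lo`, `0` for `r ≥ hi`.
[folklore] -/
def cdown (lo hi r : ℝ) : ℝ := 1 - cup lo hi r

/-- `cup lo hi` is smooth. [folklore] -/
theorem contDiff_cup (lo hi : ℝ) : ContDiff ℝ ∞ (cup lo hi) :=
  Real.smoothTransition.contDiff.comp ((contDiff_id.sub contDiff_const).div_const _)

/-- `cdown lo hi` is smooth. [folklore] -/
theorem contDiff_cdown (lo hi : ℝ) : ContDiff ℝ ∞ (cdown lo hi) :=
  contDiff_const.sub (contDiff_cup lo hi)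

/-- `cup = 0` below `lo`. [folklore] -/
theorem cup_of_le {lo hi r : ℝ} (hlh : lo < hi) (h : r ≤ lo) : cup lo hi r = 0 :=
  Real.smoothTransition.zero_of_nonpos (div_nonpos_of_nonpos_of_nonneg (by linarith) (by linarith))

/-- `cup = 1` above `hi`. [folklore] -/
theorem cup_of_ge {lo hi r : ℝ} (hlh : lo < hi) (h : hi ≤ r) : cup lo hi r = 1 :=
  Real.smoothTransition.one_of_one_le ((one_le_div (by linarith)).2 (by linarith))

/-- `cdown = 1` below `lo`. [folklore] -/
theorem cdown_of_le {lo hi r : ℝ} (hlh : lo < hi) (h : r ≤ lo) : cdown lo hi r = 1 := by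
  rw [cdown, cup_of_le hlh h, sub_zero]

/-- `cdown = 0` above `hi`. [folklore] -/
theorem cdown_of_ge {lo hi r : ℝ} (hlh : lo < hi) (h : hi ≤ r) : cdown lo hi r = 0 := by
  rw [cdown, cup_of_ge hlh h, sub_self]

/-- `0 ≤ cdown ≤ 1`. [folklore] -/
theorem cdown_mem_Icc (lo hi r : ℝ) : cdown lo hi r ∈ Icc (0 : ℝ) 1 :=
  ⟨by rw [cdown, cup]; linarith [Real.smoothTransition.le_one ((r - lo) / (hi - lo))],
    by rw [cdown, cup]; linarith [Real.smoothTransition.nonneg ((r - lo) / (hi - lo))]⟩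

/-! ### The radial profiles -/

/-- **Frozen radius** `Rf a d r = r + ((a - 2d) - r) · cdown (a - 2d) (a - d) r`: equal to `r` for
`r ≥ a - d` and to `a - 2d` for `r ≤ a - 2d`. [folklore] -/
def Rf (a d r : ℝ) : ℝ := r + ((a - 2 * d) - r) * cdown (a - 2 * d) (a - d) r

/-- **Angle-flattening weight** `χ`: `1` for `r ≤ a - 3d`, `0` for `r ≥ a - 2d`. [folklore] -/
def χf (a d r : ℝ) : ℝ := cdown (a - 3 * d) (a - 2 * d) r

/-- **Deformation parameter** `λ`: `0` for `r ≤ a - 5d`, `1` for `r ≥ a - 4d`. [folklore] -/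
def lamf (a d r : ℝ) : ℝ := cup (a - 5 * d) (a - 4 * d) r

/-- **Unwinding parameter** `κ`: `0` for `r ≤ a - 7d`, `1` for `r ≥ a - 6d`. [folklore] -/
def κf (a d r : ℝ) : ℝ := cup (a - 7 * d) (a - 6 * d) r

/-- **Flattened angle** `Tf a d r t = t + χ(r) (perStep t - t)`. [folklore] -/
def Tf (a d r t : ℝ) : ℝ := t + χf a d r * (perStep t - t)

variable {a d : ℝ}

/-- `Rf` is smooth in `r`. [folklore] -/
theorem contDiff_Rf (a d : ℝ) : ContDiff ℝ ∞ (Rf a d) :=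
  contDiff_id.add ((contDiff_const.sub contDiff_id).mul (contDiff_cdown _ _))

/-- `Rf = r` for `r ≥ a - d`. [folklore] -/
theorem Rf_of_ge (hd : 0 < d) {r : ℝ} (h : a - d ≤ r) : Rf a d r = r := by
  rw [Rf, cdown_of_ge (by linarith) h, mul_zero, add_zero]

/-- `Rf = a - 2d` for `r ≤ a - 2d`. [folklore] -/
theorem Rf_of_le (hd : 0 < d) {r : ℝ} (h : r ≤ a - 2 * d) : Rf a d r = a - 2 * d := by
  rw [Rf, cdown_of_le (by linarith) h, mul_one, add_sub_cancel]

/-- **`Rf` stays in the band radii**: `a - 2d ≤ Rf r` and `Rf r < a + 2d` for `r < a + 2d`.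
[folklore] -/
theorem Rf_mem (hd : 0 < d) {r : ℝ} (hr : r < a + 2 * d) : a - 2 * d ≤ Rf a d r ∧ Rf a d r < a + 2 * d := by
  obtain ⟨h0, h1⟩ := cdown_mem_Icc (a - 2 * d) (a - d) r
  rcases le_or_gt r (a - 2 * d) with hle | hgt
  · rw [Rf_of_le hd hle]; constructor <;> linarith
  · rw [Rf]
    constructor <;> nlinarith

/-- `0 < Rf r` when `0 < a - 2d` and `r < a + 2d`. [folklore] -/
theorem Rf_pos (hd : 0 < d) (ha : 0 < a - 2 * d) {r : ℝ} (hr : r < a + 2 * d) : 0 < Rf a d r :=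
  ha.trans_le (Rf_mem hd hr).1

/-- `Tf` is smooth in `(r, t)`. [folklore] -/
theorem contDiff_Tf (a d : ℝ) : ContDiff ℝ ∞ fun p : ℝ × ℝ ↦ Tf a d p.1 p.2 := by
  unfold Tf χf
  exact contDiff_snd.add (((contDiff_cdown _ _).comp contDiff_fst).mul
    ((contDiff_perStep.comp contDiff_snd).sub contDiff_snd))

/-- `Tf r (t + 1) = Tf r t + 1`. [folklore] -/
theorem Tf_add_one (a d r t : ℝ) : Tf a d r (t + 1) = Tf a d r t + 1 := by
  rw [Tf, Tf, perStep_add_one]; ring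

/-- `Tf r t = t` for `r ≥ a - 2d`. [folklore] -/
theorem Tf_of_ge (hd : 0 < d) {r : ℝ} (h : a - 2 * d ≤ r) (t : ℝ) : Tf a d r t = t := by
  rw [Tf, χf, cdown_of_ge (by linarith) h]; ring

/-- `Tf r t = perStep t` for `r ≤ a - 3d`. [folklore] -/
theorem Tf_of_le (hd : 0 < d) {r : ℝ} (h : r ≤ a - 3 * d) (t : ℝ) : Tf a d r t = perStep t := by
  rw [Tf, χf, cdown_of_le (by linarith) h]; ring

/-! ### The zone generators -/

section Zones

variable {Fb : Type} [TopologicalSpace Fb] [ChartedSpace (𝔼 2) Fb]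
  (Ψ₀ : Fb → Circle × Circle) (Θ : 𝔼 2 → Circle × Circle → Circle × Circle)
  (P : ℝ → ℝ → Circle × Circle → Circle × Circle) (gφ : ℝ → ℝ) (a d : ℝ)

/-- **Zone 2 generator** `G2 θ r t = (Θ (Rf r • circlePt (Tf r t)) (Ψ₀ θ)).1`. [folklore] -/
def G2 (θ : Fb) (r t : ℝ) : Circle :=
  (Θ (Rf a d r • ((circlePt (Tf a d r t) : 𝕊¹) : 𝔼 2)) (Ψ₀ θ)).1

/-- **Zone 3–4 generator**
`G3 θ r t = e^{2πi (κ(r) - 1) g(t)} · (P (λ r) (stepQ (fract t)) (Ψ₀ θ)).1`. [folklore] -/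
def G3 (θ : Fb) (r t : ℝ) : Circle :=
  Circle.exp (2 * π * ((κf a d r - 1) * gφ t)) * (P (lamf a d r) (stepQ (Int.fract t)) (Ψ₀ θ)).1

variable {Ψ₀ Θ P gφ a d}

omit [TopologicalSpace Fb] [ChartedSpace (𝔼 2) Fb] in
/-- `G2` is `1`-periodic in `t`. [folklore] -/
theorem G2_add_one (θ : Fb) (r t : ℝ) : G2 Ψ₀ Θ a d θ r (t + 1) = G2 Ψ₀ Θ a d θ r t := by
  rw [G2, G2, Tf_add_one, circlePt_add_one]

omit [TopologicalSpace Fb] [ChartedSpace (𝔼 2) Fb] in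
/-- `G3` is `1`-periodic in `t`. [folklore] -/
theorem G3_add_one (hgp : ∀ t, gφ (t + 1) = gφ t) (θ : Fb) (r t : ℝ) :
    G3 Ψ₀ P gφ a d θ r (t + 1) = G3 Ψ₀ P gφ a d θ r t := by
  rw [G3, G3, hgp, Int.fract_add_one]

omit [TopologicalSpace Fb] [ChartedSpace (𝔼 2) Fb] in
/-- **Zone 2 meets the band**: for `r ≥ a - d`, `G2 θ r t = (Θ (r • circlePt t) (Ψ₀ θ)).1`.
[folklore] -/
theorem G2_eq_outer (hd : 0 < d) {r : ℝ} (h : a - d ≤ r) (θ : Fb) (t : ℝ) :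
    G2 Ψ₀ Θ a d θ r t = (Θ (r • ((circlePt t : 𝕊¹) : 𝔼 2)) (Ψ₀ θ)).1 := by
  rw [G2, Rf_of_ge hd h, Tf_of_ge hd (by linarith) t]

omit [TopologicalSpace Fb] [ChartedSpace (𝔼 2) Fb] in
/-- In polar form on the band: `G2 θ ‖w‖ (angW w) = (Θ w (Ψ₀ θ)).1` for `‖w‖ ≥ a - d`, `w ≠ 0`.
[folklore] -/
theorem G2_polar_eq_outer (hd : 0 < d) {w : 𝔼 2} (hw : w ≠ 0) (h : a - d ≤ ‖w‖) (θ : Fb) :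
    G2 Ψ₀ Θ a d θ ‖w‖ (angW w) = (Θ w (Ψ₀ θ)).1 := by
  rw [G2_eq_outer hd h, norm_smul_circlePt_angW hw]

omit [TopologicalSpace Fb] [ChartedSpace (𝔼 2) Fb] in
/-- **Zone 2 meets zone 3**: for `a - 4d ≤ r ≤ a - 3d`, `G2 θ r t = G3 θ r t`. [folklore] -/
theorem G2_eq_G3 (hd : 0 < d)
    (hP1 : ∀ t x, P 1 t x = Θ ((a - 2 * d) • ((circlePt (stepQ t) : 𝕊¹) : 𝔼 2)) x)
    {r : ℝ} (h4 : a - 4 * d ≤ r) (h3 : r ≤ a - 3 * d) (θ : Fb) (t : ℝ) :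
    G2 Ψ₀ Θ a d θ r t = G3 Ψ₀ P gφ a d θ r t := by
  have hκ : κf a d r = 1 := cup_of_ge (by linarith) (by linarith)
  have hl : lamf a d r = 1 := cup_of_ge (by linarith) h4
  rw [G2, G3, hκ, hl, sub_self, zero_mul, mul_zero, Circle.exp_zero, one_mul, hP1,
    Rf_of_le hd (by linarith), Tf_of_le hd h3, circlePt_perStep]

omit [TopologicalSpace Fb] [ChartedSpace (𝔼 2) Fb] in
/-- **Zone 3 meets the core**: for `r ≤ a - 7d`, `G3 θ r t = (Ψ₀ θ).1`. [folklore] -/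
theorem G3_eq_inner (hd : 0 < d)
    (hP0 : ∀ t x, (P 0 (stepQ (Int.fract t)) x).1 = Circle.exp (2 * π * gφ t) * x.1)
    {r : ℝ} (h : r ≤ a - 7 * d) (θ : Fb) (t : ℝ) : G3 Ψ₀ P gφ a d θ r t = (Ψ₀ θ).1 := by
  have hκ : κf a d r = 0 := cup_of_le (by linarith) h
  have hl : lamf a d r = 0 := cup_of_le (by linarith) (by linarith)
  rw [G3, hκ, hl, hP0, ← mul_assoc, ← Circle.exp_add,
    show 2 * π * ((0 - 1) * gφ t) + 2 * π * gφ t = 0 by ring, Circle.exp_zero, one_mul]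

/-! ### Smoothness of the generators -/

/-- **The straightened family at the flattened time is jointly smooth**: `(σ, t, x) ↦
P σ (stepQ (fract t)) x` is `C^∞` — near an integer time it is the identity, elsewhere `fract`
is a translate of the identity. [folklore] -/
theorem contMDiff_P_stepQ_fract
    (hPs : ContMDiff (𝓘(ℝ, ℝ).prod (𝓘(ℝ, ℝ).prod 𝓣)) 𝓣 ∞
      fun p : ℝ × (ℝ × (Circle × Circle)) ↦ P p.1 p.2.1 p.2.2)
    (hPid : ∀ σ t, t ≤ 0 ∨ 1 ≤ t → ∀ x, P σ t x = x) :
    ContMDiff (𝓘(ℝ, ℝ).prod (𝓘(ℝ, ℝ).prod 𝓣)) 𝓣 ∞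
      fun p : ℝ × (ℝ × (Circle × Circle)) ↦ P p.1 (stepQ (Int.fract p.2.1)) p.2.2 := by
  intro p
  obtain ⟨σ, t, x⟩ := p
  by_cases hint : |t - round t| < 1 / 4
  · -- near an integer: the identity
    have hev : (fun p : ℝ × (ℝ × (Circle × Circle)) ↦ P p.1 (stepQ (Int.fract p.2.1)) p.2.2) =ᶠ[𝓝 (σ, t, x)]
        fun p ↦ p.2.2 := by
      have ho : IsOpen {p : ℝ × (ℝ × (Circle × Circle)) | |p.2.1 - round t| < 1 / 4} :=
        isOpen_lt (continuous_abs.comp ((continuous_fst.comp continuous_snd).sub continuous_const))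
          continuous_const
      filter_upwards [ho.mem_nhds (show |((σ, t, x) : ℝ × (ℝ × (Circle × Circle))).2.1 - round t| < 1 / 4
        from hint)] with p hp
      rcases stepQ_fract_of_abs_lt hp with h0 | h1
      · rw [h0]; exact hPid _ _ (Or.inl le_rfl) _
      · rw [h1]; exact hPid _ _ (Or.inr le_rfl) _
    exact (contMDiffAt_snd.comp _ contMDiffAt_snd).congr_of_eventuallyEq hev
  · -- away from the integers: `fract = id - ⌊t⌋` near `t`
    set n := ⌊t⌋ with hn
    have hlo : (n : ℝ) < t := by
      refine lt_of_le_of_ne (Int.floor_le t) fun he ↦ hint ?_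
      have : round t = n := by rw [← he, round_intCast]
      rw [this, ← he]; simp
    have hhi : t < n + 1 := Int.lt_floor_add_one t
    have hev : (fun p : ℝ × (ℝ × (Circle × Circle)) ↦ P p.1 (stepQ (Int.fract p.2.1)) p.2.2) =ᶠ[𝓝 (σ, t, x)]
        fun p ↦ P p.1 (stepQ (p.2.1 - n)) p.2.2 := by
      have ho : IsOpen {p : ℝ × (ℝ × (Circle × Circle)) | p.2.1 ∈ Ioo (n : ℝ) (n + 1)} :=
        isOpen_Ioo.preimage (continuous_fst.comp continuous_snd)
      filter_upwards [ho.mem_nhds (show ((σ, t, x) : ℝ × (ℝ × (Circle × Circle))).2.1 ∈ Ioo (n : ℝ) (n + 1)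
        from ⟨hlo, hhi⟩)] with p hp
      have hfl : ⌊p.2.1⌋ = n := Int.floor_eq_iff.2 ⟨hp.1.le, hp.2⟩
      rw [← Int.self_sub_floor, hfl]
    refine ContMDiffAt.congr_of_eventuallyEq ?_ hev
    have hin : ContMDiff (𝓘(ℝ, ℝ).prod (𝓘(ℝ, ℝ).prod 𝓣)) (𝓘(ℝ, ℝ).prod (𝓘(ℝ, ℝ).prod 𝓣)) ∞
        fun p : ℝ × (ℝ × (Circle × Circle)) ↦ ((p.1, (stepQ (p.2.1 - n), p.2.2)) : ℝ × (ℝ × (Circle × Circle))) := by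
      refine contMDiff_fst.prodMk (ContMDiff.prodMk ?_ (contMDiff_snd.comp contMDiff_snd))
      exact ((contDiff_stepQ.comp (contDiff_id.sub contDiff_const)).contMDiff).comp
        (contMDiff_fst.comp contMDiff_snd)
    exact (hPs.comp hin).contMDiffAt

/-- **`G3` is jointly smooth in `(θ, r, t)`.** [folklore] -/
theorem contMDiff_G3 (hΨs : ContMDiff (𝓡 2) 𝓣 ∞ Ψ₀)
    (hPs : ContMDiff (𝓘(ℝ, ℝ).prod (𝓘(ℝ, ℝ).prod 𝓣)) 𝓣 ∞
      fun p : ℝ × (ℝ × (Circle × Circle)) ↦ P p.1 p.2.1 p.2.2)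
    (hPid : ∀ σ t, t ≤ 0 ∨ 1 ≤ t → ∀ x, P σ t x = x) (hgs : ContDiff ℝ ∞ gφ) :
    ContMDiff ((𝓡 2).prod (𝓘(ℝ, ℝ).prod 𝓘(ℝ, ℝ))) (𝓡 1) ∞
      fun q : Fb × (ℝ × ℝ) ↦ G3 Ψ₀ P gφ a d q.1 q.2.1 q.2.2 := by
  -- the rotation factor
  have hrot : ContMDiff ((𝓡 2).prod (𝓘(ℝ, ℝ).prod 𝓘(ℝ, ℝ))) (𝓡 1) ∞
      fun q : Fb × (ℝ × ℝ) ↦ Circle.exp (2 * π * ((κf a d q.2.1 - 1) * gφ q.2.2)) := by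
    have hr : ContMDiff ((𝓡 2).prod (𝓘(ℝ, ℝ).prod 𝓘(ℝ, ℝ))) 𝓘(ℝ, ℝ) ∞ fun q : Fb × (ℝ × ℝ) ↦ q.2.1 :=
      contMDiff_fst.comp contMDiff_snd
    have ht : ContMDiff ((𝓡 2).prod (𝓘(ℝ, ℝ).prod 𝓘(ℝ, ℝ))) 𝓘(ℝ, ℝ) ∞ fun q : Fb × (ℝ × ℝ) ↦ q.2.2 :=
      contMDiff_snd.comp contMDiff_snd
    have hκ : ContMDiff ((𝓡 2).prod (𝓘(ℝ, ℝ).prod 𝓘(ℝ, ℝ))) 𝓘(ℝ, ℝ) ∞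
        fun q : Fb × (ℝ × ℝ) ↦ 2 * π * ((κf a d q.2.1 - 1) * gφ q.2.2) :=
      contMDiff_const.mul ((((contDiff_cup _ _).contMDiff.comp hr).sub contMDiff_const).mul
        (hgs.contMDiff.comp ht))
    exact contMDiff_circleExp.comp hκ
  -- the deformation factor
  have hin : ContMDiff ((𝓡 2).prod (𝓘(ℝ, ℝ).prod 𝓘(ℝ, ℝ))) (𝓘(ℝ, ℝ).prod (𝓘(ℝ, ℝ).prod 𝓣)) ∞
      fun q : Fb × (ℝ × ℝ) ↦ ((lamf a d q.2.1, (q.2.2, Ψ₀ q.1)) : ℝ × (ℝ × (Circle × Circle))) :=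
    (((contDiff_cup _ _).contMDiff.comp (contMDiff_fst.comp contMDiff_snd))).prodMk
      ((contMDiff_snd.comp contMDiff_snd).prodMk (hΨs.comp contMDiff_fst))
  have hdef := contMDiff_fst.comp ((contMDiff_P_stepQ_fract hPs hPid).comp hin)
  have hdef' : ContMDiff ((𝓡 2).prod (𝓘(ℝ, ℝ).prod 𝓘(ℝ, ℝ))) (𝓡 1) ∞
      fun q : Fb × (ℝ × ℝ) ↦ (P (lamf a d q.2.1) (stepQ (Int.fract q.2.2)) (Ψ₀ q.1)).1 := hdef
  exact hrot.mul hdef'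

/-- **`G2` is jointly smooth in `(θ, r, t)` for `r < a + 2d`**, when `Θ` is jointly smooth over the
annulus `a - 3d < ‖w‖ < a + 2d`. [folklore] -/
theorem contMDiffAt_G2 (hd : 0 < d) (ha : 0 < a - 2 * d) (hΨs : ContMDiff (𝓡 2) 𝓣 ∞ Ψ₀)
    (hΘs : ContMDiffOn (𝓘(ℝ, 𝔼 2).prod 𝓣) 𝓣 ∞ (fun q : 𝔼 2 × (Circle × Circle) ↦ Θ q.1 q.2)
      ({w : 𝔼 2 | a - 3 * d < ‖w‖ ∧ ‖w‖ < a + 2 * d} ×ˢ univ))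
    (θ : Fb) {r : ℝ} (hr : r < a + 2 * d) (t : ℝ) :
    ContMDiffAt ((𝓡 2).prod (𝓘(ℝ, ℝ).prod 𝓘(ℝ, ℝ))) (𝓡 1) ∞
      (fun q : Fb × (ℝ × ℝ) ↦ G2 Ψ₀ Θ a d q.1 q.2.1 q.2.2) (θ, r, t) := by
  -- the inner map `(θ, r, t) ↦ (Rf r • circlePt (Tf r t), Ψ₀ θ)`
  have hw : ContDiff ℝ ∞ fun p : ℝ × ℝ ↦ Rf a d p.1 • ((circlePt (Tf a d p.1 p.2) : 𝕊¹) : 𝔼 2) := by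
    have h1 : ContMDiff 𝓘(ℝ, ℝ × ℝ) 𝓘(ℝ, 𝔼 2) ∞ fun p : ℝ × ℝ ↦ ((circlePt (Tf a d p.1 p.2) : 𝕊¹) : 𝔼 2) :=
      contMDiff_coe_sphere.comp (contMDiff_circlePt.comp (contDiff_Tf a d).contMDiff)
    exact ((contDiff_Rf a d).comp contDiff_fst).smul (contMDiff_iff_contDiff.1 h1)
  have hin : ContMDiff ((𝓡 2).prod (𝓘(ℝ, ℝ).prod 𝓘(ℝ, ℝ))) (𝓘(ℝ, 𝔼 2).prod 𝓣) ∞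
      fun q : Fb × (ℝ × ℝ) ↦ ((Rf a d q.2.1 • ((circlePt (Tf a d q.2.1 q.2.2) : 𝕊¹) : 𝔼 2), Ψ₀ q.1) :
        𝔼 2 × (Circle × Circle)) := by
    refine ContMDiff.prodMk ?_ (hΨs.comp contMDiff_fst)
    have h2 : ContMDiff (𝓘(ℝ, ℝ).prod 𝓘(ℝ, ℝ)) 𝓘(ℝ, 𝔼 2) ∞
        fun p : ℝ × ℝ ↦ Rf a d p.1 • ((circlePt (Tf a d p.1 p.2) : 𝕊¹) : 𝔼 2) := by
      rw [← modelWithCornersSelf_prod, chartedSpaceSelf_prod]; exact hw.contMDiff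
    exact h2.comp contMDiff_snd
  -- the image point lies in the annulus
  have hmem : ((Rf a d r • ((circlePt (Tf a d r t) : 𝕊¹) : 𝔼 2), Ψ₀ θ) : 𝔼 2 × (Circle × Circle)) ∈
      {w : 𝔼 2 | a - 3 * d < ‖w‖ ∧ ‖w‖ < a + 2 * d} ×ˢ (univ : Set (Circle × Circle)) := by
    refine ⟨?_, mem_univ _⟩
    change a - 3 * d < ‖Rf a d r • _‖ ∧ ‖Rf a d r • _‖ < a + 2 * d
    rw [norm_smul_circlePt (Rf_pos hd ha hr).le]
    obtain ⟨h1, h2⟩ := Rf_mem hd hr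
    exact ⟨by linarith, h2⟩
  have hopen : IsOpen ({w : 𝔼 2 | a - 3 * d < ‖w‖ ∧ ‖w‖ < a + 2 * d} ×ˢ (univ : Set (Circle × Circle))) :=
    ((isOpen_Ioo (a := a - 3 * d) (b := a + 2 * d)).preimage continuous_norm).prod isOpen_univ
  have hΘat := hΘs.contMDiffAt (hopen.mem_nhds hmem)
  have hcomp := contMDiffAt_fst.comp (θ, r, t) (hΘat.comp (θ, r, t) hin.contMDiffAt)
  exact hcomp

end Zones

end DiscExt

end Summit.SmoothPoincare4.SmoothPoincare4.Cruxes.RungOne.Sketch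

end
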